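import Summits.Ventures.HodgeRepro2.T5SU11FibrationHaar
import Summits.Ventures.HodgeRepro2.T5RuhlRadial
import Summits.Ventures.HodgeRepro2.DiscMeanValue

/-!
# The lowest-weight matrix coefficient of the weighted Bergman model

The holomorphic discrete series of weight `k` of `SU(1,1)` is realised on the weighted Bergman
space of the disc, with inner product `⟨f₁, f₂⟩ = ∫_𝔻 f₁ f̄₂ (1 - |z|²)^{k-2} dA` and the action
`(π_k(g) f)(z) = j(g⁻¹, z)^{-k} f(g⁻¹ · z)`, `j(g⁻¹, z) = a - b̄ z` for `g = su11 a b`.  The constant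
function `1` is the lowest-weight vector, and its matrix coefficient is

  `⟨π_k(g) 1, 1⟩ = ∫_𝔻 (a - b̄ z)^{-k} (1 - |z|²)^{k-2} dA = a^{-k} ⟨1, 1⟩`

by the mean-value property of the holomorphic function `z ↦ (a - b̄ z)^{-k}` (holomorphic on a
neighbourhood of the closed disc since `|a| > |b|`) against the radial weight.  Hence
`|⟨π_k(g) 1, 1⟩| = ‖1‖² |a|^{-k} = ‖1‖² (1 - |g·0|²)^{k/2}` — for `k = 3` this is the support map's
`|⟨π(g) f, f⟩| = ‖f‖² cosh(η/2)^{-3}` (S4 l. 82) in the disc picture, since `|a| = cosh(η/2)`.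

This file proves the mean-value property `∫_𝔻 h(z) w(|z|) dA = h(0) ∫_𝔻 w(|z|) dA` for `h`
holomorphic on the disc and continuous up to the boundary and `w` continuous (the circle mean
value `DiscMeanValue.integral_angle` on every circle `|z| = r`, polar coordinates, Fubini), and the
coefficient formula for the explicit model, together with the representation property of the
action.

Blind lane: Mathlib + the HodgeRepro2 prefix only (own files + p2's `DiscMeanValue` for the circle
mean value); no sorry; axioms ⊆ {propext, Classical.choice, Quot.sound}.
-/

namespace Summit.Ventures.HodgeRepro2.T5BergmanCoefficient

open MeasureTheory MeasureTheory.Measure Metric Complex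
open scoped Real

/-! ### Polar coordinates on the disc -/

/-- The polar map `(r, θ) ↦ r e^{iθ}` is continuous. -/
lemma continuous_pol : Continuous (fun q : ℝ × ℝ => circleMap 0 q.1 q.2) := by
  unfold circleMap
  fun_prop

/-- **The disc integral in polar coordinates** (Bochner version):
`∫_𝔻 F dA = ∫_{(0,1) × (-π,π)} r F(r e^{iθ}) dr dθ`. -/
theorem integral_ball_eq_polar (F : ℂ → ℂ) :
    ∫ z in ball (0 : ℂ) 1, F z =
      ∫ q in Set.Ioo (0 : ℝ) 1 ×ˢ Set.Ioo (-π) π, q.1 • F (circleMap 0 q.1 q.2) := by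
  have key := Complex.integral_comp_polarCoord_symm ((ball (0 : ℂ) 1).indicator F)
  rw [integral_indicator measurableSet_ball] at key
  rw [← key, polarCoord_target]
  have e : ∀ q ∈ Set.Ioi (0 : ℝ) ×ˢ Set.Ioo (-π) π,
      q.1 • (ball (0 : ℂ) 1).indicator F (Complex.polarCoord.symm q) =
      (Set.Ioo (0 : ℝ) 1 ×ˢ Set.Ioo (-π) π).indicator
        (fun q : ℝ × ℝ => q.1 • F (circleMap 0 q.1 q.2)) q := by
    rintro ⟨r, θ⟩ ⟨hr, hθ⟩
    simp only [Set.mem_Ioi] at hr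
    rw [← zero_add (Complex.polarCoord.symm (r, θ)), DiscMeanValue.add_polarCoord_symm]
    have hn : ‖circleMap 0 r θ‖ = r := by rw [norm_circleMap_zero, abs_of_pos hr]
    by_cases h1 : r < 1
    · have hmem : circleMap 0 r θ ∈ ball (0 : ℂ) 1 := by rw [mem_ball_zero_iff, hn]; exact h1
      rw [Set.indicator_of_mem hmem, Set.indicator_of_mem
        (show (r, θ) ∈ Set.Ioo (0 : ℝ) 1 ×ˢ Set.Ioo (-π) π from ⟨⟨hr, h1⟩, hθ⟩)]
    · have hmem : circleMap 0 r θ ∉ ball (0 : ℂ) 1 := by rw [mem_ball_zero_iff, hn]; exact h1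
      rw [Set.indicator_of_notMem hmem, Set.indicator_of_notMem
        (show (r, θ) ∉ Set.Ioo (0 : ℝ) 1 ×ˢ Set.Ioo (-π) π from fun h => h1 h.1.2), smul_zero]
  rw [setIntegral_congr_fun (measurableSet_Ioi.prod measurableSet_Ioo) e,
    setIntegral_indicator (measurableSet_Ioo.prod measurableSet_Ioo),
    Set.inter_eq_right.mpr (Set.prod_mono Set.Ioo_subset_Ioi_self le_rfl)]

/-- Fubini on `(0,1) × (-π,π)` for an integrable integrand. -/
theorem integral_prod_Ioo (G : ℝ × ℝ → ℂ)
    (hG : IntegrableOn G (Set.Ioo (0 : ℝ) 1 ×ˢ Set.Ioo (-π) π)) :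
    ∫ q in Set.Ioo (0 : ℝ) 1 ×ˢ Set.Ioo (-π) π, G q =
      ∫ r in Set.Ioo (0 : ℝ) 1, ∫ θ in Set.Ioo (-π) π, G (r, θ) := by
  rw [IntegrableOn, Measure.volume_eq_prod, ← Measure.prod_restrict] at hG
  rw [Measure.volume_eq_prod, ← Measure.prod_restrict]
  exact integral_prod G hG

/-! ### The mean-value property against a radial weight -/

/-- The integrand `q ↦ q.1 • (h (r e^{iθ}) · w(r))` is continuous on `[0,1] × [-π,π]` for `h`
continuous on the closed disc and `w` continuous. -/
lemma continuousOn_polar_integrand (h : ℂ → ℂ) (hh : ContinuousOn h (closedBall 0 1))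
    (w : ℝ → ℝ) (hw : Continuous w) :
    ContinuousOn (fun q : ℝ × ℝ =>
        q.1 • (h (circleMap 0 q.1 q.2) * (w ‖circleMap 0 q.1 q.2‖ : ℂ)))
      (Set.Icc (0 : ℝ) 1 ×ˢ Set.Icc (-π) π) := by
  have hmaps : Set.MapsTo (fun q : ℝ × ℝ => circleMap 0 q.1 q.2)
      (Set.Icc (0 : ℝ) 1 ×ˢ Set.Icc (-π) π) (closedBall 0 1) := by
    rintro ⟨r, θ⟩ ⟨hr, _⟩
    rw [mem_closedBall_zero_iff, norm_circleMap_zero, abs_of_nonneg hr.1]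
    exact hr.2
  have h1 : ContinuousOn (fun q : ℝ × ℝ => h (circleMap 0 q.1 q.2))
      (Set.Icc (0 : ℝ) 1 ×ˢ Set.Icc (-π) π) :=
    hh.comp continuous_pol.continuousOn hmaps
  have h2 : Continuous (fun q : ℝ × ℝ => (w ‖circleMap 0 q.1 q.2‖ : ℂ)) :=
    continuous_ofReal.comp (hw.comp (continuous_norm.comp continuous_pol))
  exact continuous_fst.continuousOn.smul (h1.mul h2.continuousOn)

/-- **Mean value against a radial weight**: for `h` holomorphic on the closed disc and `w`
continuous, `∫_𝔻 h(z) w(|z|) dA = 2π h(0) ∫_0^1 r w(r) dr`. -/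
theorem integral_ball_mul_radial (h : ℂ → ℂ) (hh : DiffContOnCl ℂ h (ball 0 1))
    (w : ℝ → ℝ) (hw : Continuous w) :
    ∫ z in ball (0 : ℂ) 1, h z * (w ‖z‖ : ℂ) =
      (2 * π * h 0) * ∫ r in Set.Ioo (0 : ℝ) 1, ((r : ℂ) * w r) := by
  rw [integral_ball_eq_polar]
  have hint : IntegrableOn (fun q : ℝ × ℝ =>
      q.1 • (h (circleMap 0 q.1 q.2) * (w ‖circleMap 0 q.1 q.2‖ : ℂ)))
      (Set.Ioo (0 : ℝ) 1 ×ˢ Set.Ioo (-π) π) :=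
    ((continuousOn_polar_integrand h hh.continuousOn_ball w hw).integrableOn_compact
      (isCompact_Icc.prod isCompact_Icc)).mono_set
      (Set.prod_mono Set.Ioo_subset_Icc_self Set.Ioo_subset_Icc_self)
  rw [integral_prod_Ioo _ hint]
  have inner : ∀ r ∈ Set.Ioo (0 : ℝ) 1,
      ∫ θ in Set.Ioo (-π) π, r • (h (circleMap 0 r θ) * (w ‖circleMap 0 r θ‖ : ℂ)) =
        (2 * π * h 0) * ((r : ℂ) * w r) := by
    intro r hr
    have hn : ∀ θ : ℝ, ‖circleMap 0 r θ‖ = r := fun θ => by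
      rw [norm_circleMap_zero, abs_of_pos hr.1]
    have e : ∀ θ : ℝ, r • (h (circleMap 0 r θ) * (w ‖circleMap 0 r θ‖ : ℂ)) =
        ((r : ℂ) * w r) * h (circleMap 0 r θ) := by
      intro θ
      rw [hn, Complex.real_smul]
      ring
    simp_rw [e]
    rw [integral_const_mul, DiscMeanValue.integral_angle hh hr.1 hr.2, Complex.real_smul]
    push_cast
    ring
  rw [setIntegral_congr_fun measurableSet_Ioo inner, integral_const_mul]

/-- The weight alone: `∫_𝔻 w(|z|) dA = 2π ∫_0^1 r w(r) dr`. -/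
theorem integral_ball_radial (w : ℝ → ℝ) (hw : Continuous w) :
    ∫ z in ball (0 : ℂ) 1, (w ‖z‖ : ℂ) = (2 * π) * ∫ r in Set.Ioo (0 : ℝ) 1, ((r : ℂ) * w r) := by
  have := integral_ball_mul_radial (fun _ => (1 : ℂ)) (differentiableOn_const 1).diffContOnCl w hw
  simp only [one_mul, mul_one] at this
  exact this

/-- **The mean-value property on the disc**: `∫_𝔻 h(z) w(|z|) dA = h(0) ∫_𝔻 w(|z|) dA`. -/
theorem integral_ball_mul_radial_eq (h : ℂ → ℂ) (hh : DiffContOnCl ℂ h (ball 0 1))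
    (w : ℝ → ℝ) (hw : Continuous w) :
    ∫ z in ball (0 : ℂ) 1, h z * (w ‖z‖ : ℂ) = h 0 * ∫ z in ball (0 : ℂ) 1, (w ‖z‖ : ℂ) := by
  rw [integral_ball_mul_radial h hh w hw, integral_ball_radial w hw]
  ring

/-! ### The weighted Bergman model of the discrete series -/

open T5PoincareDensity T5SU11Unimodular T5SU11Fibration

/-- The matrix of `g ∈ SU(1,1)`. -/
abbrev mat (g : SU11) : Matrix (Fin 2) (Fin 2) ℂ :=
  ((g : Matrix.SpecialLinearGroup (Fin 2) ℂ) : Matrix (Fin 2) (Fin 2) ℂ)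

/-- The matrix of `g⁻¹` is `su11 ā (-b)` for `g = su11 a b` (the adjugate). -/
lemma mat_inv (g : SU11) :
    mat g⁻¹ = su11 ((starRingEnd ℂ) (mat g 0 0)) (-(mat g 0 1)) := by
  have h1 : mat g⁻¹ = (mat g).adjugate := by
    show (((g⁻¹ : SU11) : Matrix.SpecialLinearGroup (Fin 2) ℂ) : Matrix (Fin 2) (Fin 2) ℂ) = _
    rw [Subgroup.coe_inv, Matrix.SpecialLinearGroup.coe_inv]
  have h2 := coe_eq_su11 g
  rw [h1, Matrix.adjugate_fin_two]
  have e10 : mat g 1 0 = (starRingEnd ℂ) (mat g 0 1) := by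
    rw [show mat g 1 0 = su11 (mat g 0 0) (mat g 0 1) 1 0 from congrFun (congrFun h2 1) 0]
    simp [su11]
  have e11 : mat g 1 1 = (starRingEnd ℂ) (mat g 0 0) := by
    rw [show mat g 1 1 = su11 (mat g 0 0) (mat g 0 1) 1 1 from congrFun (congrFun h2 1) 1]
    simp [su11]
  rw [e10, e11]
  simp [su11]

/-- The lowest-weight vector: the constant function `1`. -/
def lowest : ℂ → ℂ := fun _ => 1

/-- The weight-`k` action of `SU(1,1)` on functions on the disc:
`(π_k(g) f)(z) = j(g⁻¹, z)^{-k} · f(g⁻¹ · z)` with the automorphy factor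
`j(g⁻¹, z) = denom (g⁻¹) z = a - b̄ z` for `g = su11 a b`. -/
noncomputable def act (k : ℕ) (g : SU11) (f : ℂ → ℂ) (z : ℂ) : ℂ :=
  (denom (mat g⁻¹) z)⁻¹ ^ k * f (mobius (mat g⁻¹) z)

/-- The weight-`k` Bergman pairing `⟨f₁, f₂⟩_k = ∫_𝔻 f₁ f̄₂ (1 - |z|²)^{k-2} dA`. -/
noncomputable def pairing (k : ℕ) (f₁ f₂ : ℂ → ℂ) : ℂ :=
  ∫ z in ball (0 : ℂ) 1, f₁ z * (starRingEnd ℂ) (f₂ z) * (((1 - ‖z‖ ^ 2) ^ (k - 2) : ℝ) : ℂ)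

/-- `j(g⁻¹, z) = a - b̄ z`. -/
lemma denom_inv_eq (g : SU11) (z : ℂ) :
    denom (mat g⁻¹) z = mat g 0 0 - (starRingEnd ℂ) (mat g 0 1) * z := by
  rw [mat_inv, denom_su11]
  simp only [map_neg, Complex.conj_conj]
  ring

/-- `j(g⁻¹, z) ≠ 0` on the closed disc (`|b̄ z| ≤ |b| < |a|`). -/
lemma denom_inv_ne_zero (g : SU11) {z : ℂ} (hz : z ∈ closedBall (0 : ℂ) 1) :
    denom (mat g⁻¹) z ≠ 0 := by
  rw [denom_inv_eq]
  intro h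
  have hab := normSq_sub_normSq g
  have h' : mat g 0 0 = (starRingEnd ℂ) (mat g 0 1) * z := sub_eq_zero.mp h
  have hn : ‖mat g 0 0‖ ≤ ‖mat g 0 1‖ := by
    rw [h', norm_mul, Complex.norm_conj]
    exact mul_le_of_le_one_right (norm_nonneg _) (mem_closedBall_zero_iff.mp hz)
  have : Complex.normSq (mat g 0 0) ≤ Complex.normSq (mat g 0 1) := by
    rw [Complex.normSq_eq_norm_sq, Complex.normSq_eq_norm_sq]
    exact pow_le_pow_left₀ (norm_nonneg _) hn 2
  linarith

/-- `(π_k(g) 1)(z) = j(g⁻¹, z)^{-k}`. -/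
lemma act_lowest_apply (k : ℕ) (g : SU11) (z : ℂ) :
    act k g lowest z = (denom (mat g⁻¹) z)⁻¹ ^ k := by
  simp [act, lowest]

/-- `π_k(g) 1` is holomorphic on the closed disc. -/
lemma differentiableOn_act_lowest (k : ℕ) (g : SU11) :
    DifferentiableOn ℂ (act k g lowest) (closedBall 0 1) := by
  have e : act k g lowest = (fun z => denom (mat g⁻¹) z)⁻¹ ^ k := by
    ext z
    simp [act_lowest_apply]
  rw [e]
  apply DifferentiableOn.pow
  apply DifferentiableOn.inv
  · simp only [denom]
    exact ((differentiableOn_const _).mul differentiableOn_id).add (differentiableOn_const _)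
  · intro z hz
    exact denom_inv_ne_zero g hz

/-- **The lowest-weight matrix coefficient**: `⟨π_k(g) 1, 1⟩_k = a^{-k} ⟨1, 1⟩_k` for `g = su11 a b`
(the mean-value property against the radial weight `(1 - |z|²)^{k-2}`). -/
theorem pairing_act_lowest (k : ℕ) (g : SU11) :
    pairing k (act k g lowest) lowest = (mat g 0 0)⁻¹ ^ k * pairing k lowest lowest := by
  unfold pairing
  have hw : Continuous (fun r : ℝ => (1 - r ^ 2) ^ (k - 2)) := by fun_prop
  have hd : DiffContOnCl ℂ (act k g lowest) (ball 0 1) :=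
    DifferentiableOn.diffContOnCl (by rw [closure_ball (0 : ℂ) one_ne_zero]; exact differentiableOn_act_lowest k g)
  have key := integral_ball_mul_radial_eq (act k g lowest) hd (fun r => (1 - r ^ 2) ^ (k - 2)) hw
  simp only [lowest, map_one, mul_one, one_mul] at key ⊢
  rw [key, act_lowest_apply, denom_inv_eq]
  simp

/-- `|⟨π_k(g) 1, 1⟩_k| = |a|^{-k} |⟨1, 1⟩_k|`. -/
theorem norm_pairing_act_lowest (k : ℕ) (g : SU11) :
    ‖pairing k (act k g lowest) lowest‖ = ‖mat g 0 0‖⁻¹ ^ k * ‖pairing k lowest lowest‖ := by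
  rw [pairing_act_lowest, norm_mul, norm_pow, norm_inv]

/-- `g · 0 = b / ā`. -/
lemma orbit_eq (g : SU11) : orbit g = mat g 0 1 / (starRingEnd ℂ) (mat g 0 0) := by
  unfold orbit
  conv_lhs => rw [coe_eq_su11 g]
  rw [mobius_su11]
  simp

/-- `1 - |g · 0|² = |a|^{-2}` — the disc-picture form of `cosh(η/2)^{-2}`. -/
lemma one_sub_norm_orbit_sq (g : SU11) : 1 - ‖orbit g‖ ^ 2 = ‖mat g 0 0‖⁻¹ ^ 2 := by
  have hab := normSq_sub_normSq g
  have ha : Complex.normSq (mat g 0 0) ≠ 0 := by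
    intro h
    linarith [Complex.normSq_nonneg (mat g 0 1)]
  rw [orbit_eq, norm_div, Complex.norm_conj, div_pow, inv_pow, ← Complex.normSq_eq_norm_sq,
    ← Complex.normSq_eq_norm_sq]
  field_simp
  linarith

/-- **The weight-3 coefficient squared**: `|⟨π₃(g) 1, 1⟩|² = (1 - |g·0|²)³ |⟨1, 1⟩|²` —
S4 l. 82's `|⟨π(g) f, f⟩| = ‖f‖² cosh(η/2)^{-3}` in the disc picture, where
`1 - |g·0|² = cosh(η/2)^{-2}`. -/
theorem norm_pairing_act_lowest_three_sq (g : SU11) :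
    ‖pairing 3 (act 3 g lowest) lowest‖ ^ 2 =
      (1 - ‖orbit g‖ ^ 2) ^ 3 * ‖pairing 3 lowest lowest‖ ^ 2 := by
  rw [norm_pairing_act_lowest, mul_pow, one_sub_norm_orbit_sq, ← pow_mul, ← pow_mul]

/-- `⟨1, 1⟩_3 = ∫_𝔻 (1 - |z|²) dA = π / 2`. -/
theorem pairing_lowest_lowest_three : pairing 3 lowest lowest = ((π / 2 : ℝ) : ℂ) := by
  unfold pairing
  simp only [lowest, map_one, mul_one, one_mul, show (3 : ℕ) - 2 = 1 from rfl, pow_one]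
  rw [integral_complex_ofReal, T5RuhlRadial.integral_ball_one_sub_norm_sq]

/-- **The explicit value**: `|⟨π₃(g) 1, 1⟩|² = (π/2)² (1 - |g·0|²)³`. -/
theorem norm_pairing_act_lowest_three_sq' (g : SU11) :
    ‖pairing 3 (act 3 g lowest) lowest‖ ^ 2 = (π / 2) ^ 2 * (1 - ‖orbit g‖ ^ 2) ^ 3 := by
  rw [norm_pairing_act_lowest_three_sq, pairing_lowest_lowest_three, Complex.norm_real,
    Real.norm_eq_abs, abs_of_pos (by positivity)]
  ring

/-! ### The representation property -/

/-- The cocycle identity of the automorphy factor: `j(MN, z) = j(M, N·z) · j(N, z)` when `j(N, z) ≠ 0`. -/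
lemma denom_mul (M N : Matrix (Fin 2) (Fin 2) ℂ) (z : ℂ) (hN : denom N z ≠ 0) :
    denom (M * N) z = denom M (mobius N z) * denom N z := by
  rw [mobius_eq]
  simp only [denom, Matrix.mul_apply, Fin.sum_univ_two] at hN ⊢
  field_simp
  ring

/-- **The representation property** on the disc: `π_k(g h) f = π_k(g) (π_k(h) f)` pointwise on `𝔻`. -/
theorem act_mul (k : ℕ) (g h : SU11) (f : ℂ → ℂ) {z : ℂ} (hz : z ∈ ball (0 : ℂ) 1) :
    act k (g * h) f z = act k g (act k h f) z := by
  have hmat : mat (g * h)⁻¹ = mat h⁻¹ * mat g⁻¹ := by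
    show ((((g * h)⁻¹ : SU11) : Matrix.SpecialLinearGroup (Fin 2) ℂ) : Matrix (Fin 2) (Fin 2) ℂ) = _
    rw [mul_inv_rev, Subgroup.coe_mul, Matrix.SpecialLinearGroup.coe_mul]
  have hg : denom (mat g⁻¹) z ≠ 0 := denom_inv_ne_zero g (ball_subset_closedBall hz)
  have hgz : mobius (mat g⁻¹) z ∈ ball (0 : ℂ) 1 := mobius_mem_ball g⁻¹ hz
  have hh : denom (mat h⁻¹) (mobius (mat g⁻¹) z) ≠ 0 :=
    denom_inv_ne_zero h (ball_subset_closedBall hgz)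
  unfold act
  rw [hmat, denom_mul _ _ _ hg, mobius_mul _ _ _ hg (by rw [denom_mul _ _ _ hg]; exact mul_ne_zero hh hg),
    mul_inv, mul_pow]
  ring

/-- `π_k(1) f = f`. -/
theorem act_one (k : ℕ) (f : ℂ → ℂ) (z : ℂ) : act k 1 f z = f z := by
  have hmat : mat (1 : SU11)⁻¹ = 1 := by
    show ((((1 : SU11)⁻¹ : SU11) : Matrix.SpecialLinearGroup (Fin 2) ℂ) : Matrix (Fin 2) (Fin 2) ℂ) = _
    rw [inv_one, Subgroup.coe_one, Matrix.SpecialLinearGroup.coe_one]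
  unfold act
  rw [hmat, mobius_eq]
  simp [denom]

end Summit.Ventures.HodgeRepro2.T5BergmanCoefficient
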